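import Mathlib.Analysis.SpecialFunctions.ImproperIntegrals
import Literature.MathematicalPhysics.QuantumManyBody.EliashbergTcCouplingMonotonicity
import Literature.MathematicalPhysics.QuantumManyBody.EliashbergTcFrequencyScaling

/-!
# The Eliashberg phonon matrix is positive semidefinite

This file discharges the hypothesis `Λ ⪰ 0` of
`Literature.MathematicalPhysics.QuantumManyBody.eigenvalues₀_max_couplingScaledKernel_mono`
(monotonicity of the linearised isotropic Migdal–Eliashberg `T_c` under a scaling of the coupling)
for every phonon matrix the solvers actually build.

On the Matsubara frequencies `ω_n = (2n+1)πT` the phonon part of the symmetrised linearised kernel is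
`Λ_{nm} = λ(ω_n − ω_m) + λ(ω_n + ω_m)` (Toeplitz plus Hankel in the even gap sector) with
`λ(ν) = ∫ α²F(ω) · 2ω/(ω² + ν²) dω` [cite: AllenDynes1975, Eqs. (9)–(12)]; numerically `λ` is a
nonnegative quadrature `λ(ν) = Σ_i c_i · 2ω_i/(ω_i² + ν²)`, `c_i = w_i α²F(ω_i) ≥ 0`, `ω_i > 0`
(clipped spectrum). The Laplace representation `ω/(ω² + ν²) = ∫₀^∞ e^{−ωt} cos(νt) dt` and the
product formula `cos(A − B) + cos(A + B) = 2 cos A cos B` give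
`yᵀ Λ y = Σ_i 2c_i ∫₀^∞ e^{−ω_i t} · 2 (Σ_n y_n cos(ω_n t))² dt ≥ 0`
(a continuous Gram factorisation; pointed out in this programme's conventional-branch cell by its
referee, note V59, 2026-08-27). Hence `Λ ⪰ 0` is STRUCTURAL for every clipped `α²F ≥ 0`, and the
`f`-box corner rule of the `T_c` band holds with no hypothesis left to check numerically.

Proved here:
* `integral_exp_neg_mul_cos_Ioi` — `∫_{t>0} e^{−ωt} cos(νt) dt = ω/(ω² + ν²)` for `ω > 0`
  (real part of Mathlib's `integral_exp_mul_complex_Ioi`);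
* `lorentzPairKernel`, `sum_sum_lorentzPairKernel_nonneg` — for `ω > 0` and any reals `a_n`, the
  matrix `ω/(ω² + (a_n − a_m)²) + ω/(ω² + (a_n + a_m)²)` is positive semidefinite;
* `phononMatrix`, `isHermitian_phononMatrix`, `phononMatrix_posSemidef` — the quadrature phonon
  matrix `Λ_{nm} = Σ_i c_i (2ω_i/(ω_i² + (a_n − a_m)²) + 2ω_i/(ω_i² + (a_n + a_m)²))` with `c ≥ 0`,
  `ω_i > 0` is symmetric and positive semidefinite;
* `eigenvalues₀_max_couplingScaledKernel_phononMatrix_mono` — the corner rule of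
  `EliashbergTcCouplingMonotonicity` with its `Λ ⪰ 0` hypothesis discharged;
* (appended) `phononMatrixOfSpectrum`, `phononMatrixOfSpectrum_apply_eq_matsubaraCoupling_add`,
  `phononMatrixOfSpectrum_posSemidef` — the continuum form `Λ[α²F]_{nm} = ∫ α²F(ω)·2M_{nm}(ω) dω`
  (`= λ(a_n−a_m) + λ(a_n+a_m)` in terms of `matsubaraCoupling`) is PSD for every `α²F ≥ 0` whose
  entries exist.

## References
* [AllenDynes1975] P. B. Allen, R. C. Dynes, Phys. Rev. B 12 (1975) 905 — Eqs. (9)–(12).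
* [HornJohnson2013] R. A. Horn, C. R. Johnson, *Matrix Analysis*, 2nd ed., CUP 2013 — §7.1
  (the positive semidefinite cone; Gram matrices).
-/

noncomputable section

open scoped Matrix
open MeasureTheory Set Real Finset

namespace Literature.MathematicalPhysics.QuantumManyBody

open _root_.Matrix Literature.Analysis.Matrix

/-! ### The Laplace representation of the Lorentzian -/

/-- `t ↦ e^{−ωt} cos(νt)` is integrable on `(0, ∞)` for `ω > 0` (it is the real part of
`e^{(−ω + iν)t}`). [cite: AllenDynes1975, Eqs. (9)–(12)] -/
theorem integrableOn_exp_neg_mul_cos_Ioi {ω : ℝ} (hω : 0 < ω) (ν : ℝ) :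
    IntegrableOn (fun t : ℝ => Real.exp (-ω * t) * Real.cos (ν * t)) (Ioi 0) := by
  have ha : ((-ω : ℂ) + ν * Complex.I).re < 0 := by simp [hω]
  have h : IntegrableOn (fun t : ℝ => RCLike.re (Complex.exp (((-ω : ℂ) + ν * Complex.I) * (t : ℂ))))
      (Ioi 0) := (integrableOn_exp_mul_complex_Ioi ha 0).re
  refine IntegrableOn.congr_fun h (fun t _ => ?_) measurableSet_Ioi
  show RCLike.re (Complex.exp (((-ω : ℂ) + ν * Complex.I) * (t : ℂ))) = Real.exp (-ω * t) * Real.cos (ν * t)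
  rw [show ((-ω : ℂ) + ν * Complex.I) * (t : ℂ) = ((-ω * t : ℝ) : ℂ) + ((ν * t : ℝ) : ℂ) * Complex.I by
    push_cast; ring]
  rw [RCLike.re_eq_complex_re, Complex.exp_re, Complex.add_re, Complex.ofReal_re,
    Complex.re_ofReal_mul, Complex.I_re, mul_zero, add_zero, Complex.add_im, Complex.ofReal_im,
    Complex.im_ofReal_mul, Complex.I_im, mul_one, zero_add]

/-- **Laplace transform of the cosine**: `∫_{t>0} e^{−ωt} cos(νt) dt = ω / (ω² + ν²)` for `ω > 0` —
the representation of the Lorentzian `ω/(ω² + ν²)` (the kernel of `λ(ν)`) as a positive mixture of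
cosines. [cite: AllenDynes1975, Eqs. (9)–(12)] -/
theorem integral_exp_neg_mul_cos_Ioi {ω : ℝ} (hω : 0 < ω) (ν : ℝ) :
    ∫ t in Ioi (0 : ℝ), Real.exp (-ω * t) * Real.cos (ν * t) = ω / (ω ^ 2 + ν ^ 2) := by
  set a : ℂ := (-ω : ℂ) + ν * Complex.I with ha_def
  have ha : a.re < 0 := by simp [ha_def, hω]
  have hint := integral_exp_mul_complex_Ioi ha 0
  have hre : ∀ t : ℝ, Real.exp (-ω * t) * Real.cos (ν * t) = RCLike.re (Complex.exp (a * (t : ℂ))) := by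
    intro t
    rw [show a * (t : ℂ) = ((-ω * t : ℝ) : ℂ) + ((ν * t : ℝ) : ℂ) * Complex.I by
      rw [ha_def]; push_cast; ring]
    rw [RCLike.re_eq_complex_re, Complex.exp_re, Complex.add_re, Complex.ofReal_re,
      Complex.re_ofReal_mul, Complex.I_re, mul_zero, add_zero, Complex.add_im, Complex.ofReal_im,
      Complex.im_ofReal_mul, Complex.I_im, mul_one, zero_add]
  simp_rw [hre]
  rw [integral_re (integrableOn_exp_mul_complex_Ioi ha 0), hint]
  have hnz : a ≠ 0 := fun h => by rw [h, Complex.zero_re] at ha; exact lt_irrefl _ ha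
  rw [Complex.ofReal_zero, mul_zero, Complex.exp_zero, RCLike.re_eq_complex_re, neg_div,
    Complex.neg_re, one_div, Complex.inv_re]
  have hns : Complex.normSq a = ω ^ 2 + ν ^ 2 := by
    rw [ha_def, Complex.normSq_apply]; simp; ring
  rw [hns]
  simp [ha_def]
  ring

/-! ### One Lorentzian: the pair kernel is a continuous Gram matrix -/

/-- The pair kernel of ONE phonon frequency `ω` on Matsubara labels `a_n` (`= ω_n`):
`M_{nm} = ω/(ω² + (a_n − a_m)²) + ω/(ω² + (a_n + a_m)²)` — the `λ(ω_n − ω_m) + λ(ω_n + ω_m)`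
structure of the even-sector kernel for an Einstein spectrum. [cite: AllenDynes1975, Eqs. (9)–(12)] -/
def lorentzPairKernel (ω : ℝ) {ι : Type*} (a : ι → ℝ) (n m : ι) : ℝ :=
  ω / (ω ^ 2 + (a n - a m) ^ 2) + ω / (ω ^ 2 + (a n + a m) ^ 2)

/-- The cosine product formula behind the factorisation:
`cos((x − y)t) + cos((x + y)t) = 2 cos(xt) cos(yt)`. [folklore] -/
private theorem cos_sub_mul_add_cos_add_mul (x y t : ℝ) :
    Real.cos ((x - y) * t) + Real.cos ((x + y) * t) = 2 * (Real.cos (x * t) * Real.cos (y * t)) := by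
  rw [sub_mul, add_mul, Real.cos_sub, Real.cos_add]; ring

variable {ι : Type*} [Fintype ι]

/-- **The one-frequency pair kernel is positive semidefinite**: for `ω > 0` and every `y`,
`Σ_{n,m} y_n y_m M_{nm} = ∫_{t>0} e^{−ωt} · 2 (Σ_n y_n cos(a_n t))² dt ≥ 0` (continuous Gram
factorisation via the Laplace representation and the cosine product formula).
[cite: HornJohnson2013, §7.1] -/
theorem sum_sum_lorentzPairKernel_nonneg {ω : ℝ} (hω : 0 < ω) (a y : ι → ℝ) :
    0 ≤ ∑ n, ∑ m, y n * y m * lorentzPairKernel ω a n m := by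
  -- each entry as an integral
  have hentry : ∀ n m, y n * y m * lorentzPairKernel ω a n m =
      ∫ t in Ioi (0 : ℝ), y n * y m * (Real.exp (-ω * t) * (2 * (Real.cos (a n * t) * Real.cos (a m * t)))) := by
    intro n m
    rw [integral_const_mul, lorentzPairKernel, ← integral_exp_neg_mul_cos_Ioi hω (a n - a m),
      ← integral_exp_neg_mul_cos_Ioi hω (a n + a m),
      ← integral_add (integrableOn_exp_neg_mul_cos_Ioi hω _) (integrableOn_exp_neg_mul_cos_Ioi hω _)]
    congr 1
    refine setIntegral_congr_fun measurableSet_Ioi fun t _ => ?_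
    rw [← mul_add, cos_sub_mul_add_cos_add_mul]
  have hint : ∀ n m, IntegrableOn
      (fun t : ℝ => y n * y m * (Real.exp (-ω * t) * (2 * (Real.cos (a n * t) * Real.cos (a m * t))))) (Ioi 0) := by
    intro n m
    have h2 : IntegrableOn (fun t : ℝ => y n * y m *
        ((fun t : ℝ => Real.exp (-ω * t) * Real.cos ((a n - a m) * t)) +
          (fun t : ℝ => Real.exp (-ω * t) * Real.cos ((a n + a m) * t))) t) (Ioi 0) :=
      ((integrableOn_exp_neg_mul_cos_Ioi hω (a n - a m)).add
        (integrableOn_exp_neg_mul_cos_Ioi hω (a n + a m))).const_mul (y n * y m)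
    refine IntegrableOn.congr_fun h2 (fun t _ => ?_) measurableSet_Ioi
    simp only [Pi.add_apply]
    rw [← mul_add, cos_sub_mul_add_cos_add_mul]
  simp_rw [hentry]
  have hinner : ∀ n, ∑ m, ∫ t in Ioi (0 : ℝ), y n * y m *
      (Real.exp (-ω * t) * (2 * (Real.cos (a n * t) * Real.cos (a m * t)))) =
      ∫ t in Ioi (0 : ℝ), ∑ m, y n * y m *
        (Real.exp (-ω * t) * (2 * (Real.cos (a n * t) * Real.cos (a m * t)))) :=
    fun n => (integral_finsetSum _ (fun m _ => hint n m)).symm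
  rw [Finset.sum_congr rfl (fun n _ => hinner n)]
  rw [← integral_finsetSum _ (fun n _ => integrable_finsetSum _ (fun m _ => hint n m))]
  refine setIntegral_nonneg measurableSet_Ioi fun t _ => ?_
  -- Σ_n Σ_m y_n y_m e^{-ωt} 2 cos cos = e^{-ωt} * 2 * (Σ_n y_n cos(a_n t))^2
  have hsq : ∑ n, ∑ m, y n * y m * (Real.exp (-ω * t) * (2 * (Real.cos (a n * t) * Real.cos (a m * t)))) =
      Real.exp (-ω * t) * (2 * (∑ n, y n * Real.cos (a n * t)) ^ 2) := by
    rw [sq, Finset.sum_mul_sum, Finset.mul_sum, Finset.mul_sum]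
    refine Finset.sum_congr rfl fun n _ => ?_
    rw [Finset.mul_sum, Finset.mul_sum]
    refine Finset.sum_congr rfl fun m _ => ?_
    ring
  rw [hsq]
  exact mul_nonneg (Real.exp_pos _).le (mul_nonneg zero_le_two (sq_nonneg _))

/-! ### The quadrature phonon matrix -/

/-- **The (even-sector) Eliashberg phonon matrix from a nonnegative quadrature of `α²F`.**
`phononMatrix c ω a` has entries `Λ_{nm} = Σ_i c_i (2ω_i/(ω_i² + (a_n − a_m)²) + 2ω_i/(ω_i² + (a_n + a_m)²))`
`= λ(a_n − a_m) + λ(a_n + a_m)` with `λ(ν) = Σ_i c_i · 2ω_i/(ω_i² + ν²)` — the grid form of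
`λ(ν) = ∫ α²F(ω) 2ω/(ω² + ν²) dω` (`c_i = w_i α²F(ω_i)`), evaluated at `a_n = ω_n = (2n+1)πT` so that
`a_n − a_m = 2πT(n − m)` (Toeplitz part) and `a_n + a_m = 2πT(n + m + 1)` (Hankel part).
[cite: AllenDynes1975, Eqs. (9)–(12)] -/
def phononMatrix {κ : Type*} [Fintype κ] (c ω : κ → ℝ) (a : ι → ℝ) : Matrix ι ι ℝ :=
  Matrix.of fun n m => (∑ i, c i * (2 * lorentzPairKernel (ω i) a n m) : ℝ)

variable {κ : Type*} [Fintype κ]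

omit [Fintype ι] in
/-- The phonon matrix is real symmetric. [cite: AllenDynes1975, Eqs. (9)–(12)] -/
theorem isHermitian_phononMatrix (c ω : κ → ℝ) (a : ι → ℝ) : (phononMatrix c ω a).IsHermitian := by
  refine Matrix.IsHermitian.ext fun n m => ?_
  simp only [phononMatrix, Matrix.of_apply, star_trivial, lorentzPairKernel]
  refine Finset.sum_congr rfl fun i _ => ?_
  rw [show (a m - a n) ^ 2 = (a n - a m) ^ 2 by ring, add_comm (a m) (a n)]

/-- **The Eliashberg phonon matrix is positive semidefinite**: for quadrature weights `c ≥ 0` and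
frequencies `ω > 0`, `yᵀ Λ y = Σ_i 2c_i · (yᵀ M(ω_i) y) ≥ 0` for every `y`. This discharges the
hypothesis `hpsd` of `eigenvalues₀_max_couplingScaledKernel_mono` for every clipped `α²F ≥ 0`.
[cite: HornJohnson2013, §7.1] -/
theorem phononMatrix_posSemidef {c ω : κ → ℝ} (hc : ∀ i, 0 ≤ c i) (hω : ∀ i, 0 < ω i)
    (a y : ι → ℝ) : 0 ≤ y ⬝ᵥ phononMatrix c ω a *ᵥ y := by
  have hexp : y ⬝ᵥ phononMatrix c ω a *ᵥ y =
      ∑ i, 2 * c i * ∑ n, ∑ m, y n * y m * lorentzPairKernel (ω i) a n m := by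
    calc y ⬝ᵥ phononMatrix c ω a *ᵥ y
        = ∑ n, y n * ∑ m, (∑ i, c i * (2 * lorentzPairKernel (ω i) a n m)) * y m := by
          simp only [dotProduct, mulVec, phononMatrix, Matrix.of_apply]
      _ = ∑ n, ∑ m, ∑ i, 2 * c i * (y n * y m * lorentzPairKernel (ω i) a n m) := by
          refine Finset.sum_congr rfl fun n _ => ?_
          rw [Finset.mul_sum]
          refine Finset.sum_congr rfl fun m _ => ?_
          rw [Finset.sum_mul, Finset.mul_sum]
          exact Finset.sum_congr rfl fun i _ => by ring
      _ = ∑ n, ∑ i, ∑ m, 2 * c i * (y n * y m * lorentzPairKernel (ω i) a n m) :=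
          Finset.sum_congr rfl fun n _ => Finset.sum_comm
      _ = ∑ i, ∑ n, ∑ m, 2 * c i * (y n * y m * lorentzPairKernel (ω i) a n m) := Finset.sum_comm
      _ = ∑ i, 2 * c i * ∑ n, ∑ m, y n * y m * lorentzPairKernel (ω i) a n m := by
          simp only [Finset.mul_sum]
  rw [hexp]
  exact Finset.sum_nonneg fun i _ =>
    mul_nonneg (mul_nonneg zero_le_two (hc i)) (sum_sum_lorentzPairKernel_nonneg (hω i) a y)

/-! ### The corner rule with the hypothesis discharged -/

variable [DecidableEq ι]

/-- **`f`-box corner rule, unconditional form.** For the coupling-scaled linearised Eliashberg kernel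
built on a quadrature phonon matrix (`c ≥ 0`, `ω_i > 0`), bare weights `cw > 0`, renormalisation
sums `aw ≥ 0` and pseudopotential `μ ≥ 0`, the top eigenvalue is monotone non-decreasing in the
coupling scale: `0 < f₁ ≤ f₂ ⟹ λ_max(K(f₁)) ≤ λ_max(K(f₂))` — `eigenvalues₀_max_couplingScaledKernel_mono`
with `Λ ⪰ 0` supplied by `phononMatrix_posSemidef`. [cite: AllenDynes1975, Eqs. (9)–(12)] -/
theorem eigenvalues₀_max_couplingScaledKernel_phononMatrix_mono {c ω : κ → ℝ} (hc : ∀ i, 0 ≤ c i)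
    (hω : ∀ i, 0 < ω i) (a : ι → ℝ) {cw aw : ι → ℝ} (hcw : ∀ n, 0 < cw n) (haw : ∀ n, 0 ≤ aw n)
    {μ : ℝ} (hμ : 0 ≤ μ) {f₁ f₂ : ℝ} (hf₁ : 0 < f₁) (hf : f₁ ≤ f₂) (hn : 1 ≤ Fintype.card ι) :
    (isHermitian_couplingScaledKernel (isHermitian_phononMatrix c ω a) cw aw μ f₁).eigenvalues₀
        (Fin.castLE hn 0) ≤
      (isHermitian_couplingScaledKernel (isHermitian_phononMatrix c ω a) cw aw μ f₂).eigenvalues₀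
        (Fin.castLE hn 0) :=
  eigenvalues₀_max_couplingScaledKernel_mono (isHermitian_phononMatrix c ω a)
    (phononMatrix_posSemidef hc hω a) hcw haw hμ hf₁ hf hn

/-! ### Continuum form: the phonon matrix of an integrable nonnegative spectral function

(Appended 2026-08-27.) The quadrature statement above is what the solvers evaluate; the defining
object is the spectral integral `λ(ν) = ∫_{ω>0} α²F(ω) · 2ω/(ω² + ν²) dω`
(`matsubaraCoupling` of `EliashbergTcFrequencyScaling`). The same Gram argument, integrated against
`α²F ≥ 0`, gives positive semidefiniteness of the continuum phonon matrix under the sole analytic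
hypothesis that the entries exist (integrability). -/

/-- **The (even-sector) phonon matrix of a spectral function**:
`Λ[α²F]_{nm} = ∫_{ω>0} α²F(ω) · (2ω/(ω² + (a_n − a_m)²) + 2ω/(ω² + (a_n + a_m)²)) dω`
`= λ(a_n − a_m) + λ(a_n + a_m)` (when the two integrals exist), `a_n = ω_n = (2n+1)πT`.
[cite: AllenDynes1975, Eqs. (9)–(12)] -/
def phononMatrixOfSpectrum (α2F : ℝ → ℝ) (a : ι → ℝ) : Matrix ι ι ℝ :=
  Matrix.of fun n m => (∫ ω in Ioi (0 : ℝ), α2F ω * (2 * lorentzPairKernel ω a n m) : ℝ)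

omit [Fintype ι] [DecidableEq ι] in
/-- The spectral phonon matrix is real symmetric. [cite: AllenDynes1975, Eqs. (9)–(12)] -/
theorem isHermitian_phononMatrixOfSpectrum (α2F : ℝ → ℝ) (a : ι → ℝ) :
    (phononMatrixOfSpectrum α2F a).IsHermitian := by
  refine Matrix.IsHermitian.ext fun n m => ?_
  simp only [phononMatrixOfSpectrum, Matrix.of_apply, star_trivial, lorentzPairKernel]
  refine integral_congr_ae (Filter.Eventually.of_forall fun ω => ?_)
  rw [show (a m - a n) ^ 2 = (a n - a m) ^ 2 by ring, add_comm (a m) (a n)]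

omit [Fintype ι] [DecidableEq ι] in
/-- Entry of the spectral phonon matrix at Matsubara labels `a_n = (2n+1)πT` as the sum of two
Matsubara couplings `λ(2πT(n−m); T)`-type integrals: with `ν₋ = (a_n − a_m)/(2πT)` and
`ν₊ = (a_n + a_m)/(2πT)`, `Λ_{nm} = matsubaraCoupling α²F T ν₋ + matsubaraCoupling α²F T ν₊`
(for `T ≠ 0`, given integrability of the two Lorentzian integrands). [cite: AllenDynes1975, Eqs. (9)–(12)] -/
theorem phononMatrixOfSpectrum_apply_eq_matsubaraCoupling_add (α2F : ℝ → ℝ) (a : ι → ℝ) {T : ℝ}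
    (hT : T ≠ 0) (n m : ι)
    (h₁ : IntegrableOn (fun ω : ℝ => α2F ω * (2 * ω / (ω ^ 2 + (a n - a m) ^ 2))) (Ioi 0))
    (h₂ : IntegrableOn (fun ω : ℝ => α2F ω * (2 * ω / (ω ^ 2 + (a n + a m) ^ 2))) (Ioi 0)) :
    phononMatrixOfSpectrum α2F a n m =
      matsubaraCoupling α2F T ((a n - a m) / (2 * π * T)) +
        matsubaraCoupling α2F T ((a n + a m) / (2 * π * T)) := by
  have hπT : 2 * π * T ≠ 0 := mul_ne_zero (mul_ne_zero two_ne_zero Real.pi_ne_zero) hT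
  have e₁ : 2 * π * T * ((a n - a m) / (2 * π * T)) = a n - a m := by field_simp
  have e₂ : 2 * π * T * ((a n + a m) / (2 * π * T)) = a n + a m := by field_simp
  simp only [phononMatrixOfSpectrum, Matrix.of_apply, matsubaraCoupling, e₁, e₂, ← integral_add h₁ h₂]
  refine integral_congr_ae (Filter.Eventually.of_forall fun ω => ?_)
  simp only [lorentzPairKernel]
  ring

omit [DecidableEq ι] in
/-- **The spectral phonon matrix is positive semidefinite** for every `α²F ≥ 0` on `(0, ∞)` whose
Lorentzian-weighted integrals exist: `yᵀ Λ[α²F] y = ∫_{ω>0} α²F(ω) · 2 · (yᵀ M(ω) y) dω ≥ 0`, with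
`M(ω)` the one-frequency pair kernel (`sum_sum_lorentzPairKernel_nonneg`). This is the hypothesis
`Λ ⪰ 0` of `eigenvalues₀_max_couplingScaledKernel_mono` in the continuum formulation.
[cite: HornJohnson2013, §7.1] -/
theorem phononMatrixOfSpectrum_posSemidef {α2F : ℝ → ℝ} (hα : ∀ ω, 0 < ω → 0 ≤ α2F ω) (a : ι → ℝ)
    (hint : ∀ n m, IntegrableOn (fun ω : ℝ => α2F ω * (2 * lorentzPairKernel ω a n m)) (Ioi 0))
    (y : ι → ℝ) : 0 ≤ y ⬝ᵥ phononMatrixOfSpectrum α2F a *ᵥ y := by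
  have hint' : ∀ n m, IntegrableOn
      (fun ω : ℝ => y n * y m * (α2F ω * (2 * lorentzPairKernel ω a n m))) (Ioi 0) :=
    fun n m => (hint n m).const_mul (y n * y m)
  have hexp : y ⬝ᵥ phononMatrixOfSpectrum α2F a *ᵥ y =
      ∑ n, ∑ m, ∫ ω in Ioi (0 : ℝ), y n * y m * (α2F ω * (2 * lorentzPairKernel ω a n m)) := by
    simp only [dotProduct, mulVec, phononMatrixOfSpectrum, Matrix.of_apply, Finset.mul_sum]
    refine Finset.sum_congr rfl fun n _ => Finset.sum_congr rfl fun m _ => ?_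
    rw [show y n * ((∫ ω in Ioi (0 : ℝ), α2F ω * (2 * lorentzPairKernel ω a n m)) * y m) =
        (y n * y m) * ∫ ω in Ioi (0 : ℝ), α2F ω * (2 * lorentzPairKernel ω a n m) by ring,
      ← integral_const_mul]
  rw [hexp]
  have hinner : ∀ n, ∑ m, ∫ ω in Ioi (0 : ℝ), y n * y m * (α2F ω * (2 * lorentzPairKernel ω a n m)) =
      ∫ ω in Ioi (0 : ℝ), ∑ m, y n * y m * (α2F ω * (2 * lorentzPairKernel ω a n m)) :=
    fun n => (integral_finsetSum _ (fun m _ => hint' n m)).symm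
  rw [Finset.sum_congr rfl (fun n _ => hinner n)]
  rw [← integral_finsetSum _ (fun n _ => integrable_finsetSum _ (fun m _ => hint' n m))]
  refine setIntegral_nonneg measurableSet_Ioi fun ω hω => ?_
  have hω0 : 0 < ω := hω
  have hsum : ∑ n, ∑ m, y n * y m * (α2F ω * (2 * lorentzPairKernel ω a n m)) =
      2 * α2F ω * ∑ n, ∑ m, y n * y m * lorentzPairKernel ω a n m := by
    rw [Finset.mul_sum]
    refine Finset.sum_congr rfl fun n _ => ?_
    rw [Finset.mul_sum]
    exact Finset.sum_congr rfl fun m _ => by ring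
  rw [hsum]
  exact mul_nonneg (mul_nonneg zero_le_two (hα ω hω0)) (sum_sum_lorentzPairKernel_nonneg hω0 a y)

end Literature.MathematicalPhysics.QuantumManyBody

end
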